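import Literature.MathematicalPhysics.QuantumManyBody.SwapPurity
import Summits.AtomisticToContinuum.BoseEinsteinCondensation.Theorems.SoloInformedConfinementCriterion

/-!
# Soft confinement of the conditional law bounds the zero-momentum occupation

Conjunct `BoseEinsteinCondensation` of `AtomisticToContinuum`; the converse half of the confinement
criterion of `Theorems/SoloInformedConfinementCriterion`, valid for COMPLEX wave functions.

Notation as there: `Z = x :: Y`, `N = n + 1`, `Q(Y) = ∫_{Λ_L} |Ψ(x, Y)|² dx`,
`A(Y) = ∫_{Λ_L} |Ψ(x, Y)| dx`, `φ₀ = L^{-3/2} 1_{Λ_L}`, so that `|⟨φ₀, Ψ(·, Y)⟩| ≤ L^{-3/2} A(Y)`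
(`SoloInformed.nnnorm_flatOverlap_le`; equality for `Ψ ≥ 0`).

* (`SoloInformed.sq_setLIntegral_le_of_softConfined`) Cauchy–Schwarz split along a set `S ⊆ B`:
  `(∫_B f)² ≤ 2 μ(S) ∫_S f² + 2 μ(B) ∫_{B \ S} f²`. Reading: if the square-mass of `f` on `B` is
  `(θ, ε)`-SOFTLY CONFINED — a set of measure `≤ θ μ(B)` carries all but the fraction `ε` of `∫_B f²` —
  then `(∫_B f)² ≤ 2 (θ + ε) μ(B) ∫_B f²`, i.e. the ratio `m = (∫_B f)² / (μ(B) ∫_B f²)` is `≤ 2(θ + ε)`.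
* (`SoloInformed.flatOccupation_le_of_softConfined`) for any measurable family of sets
  `S_Y ⊆ Λ_L` (one per environment):
  `⟨φ₀, γ_Ψ φ₀⟩ ≤ N ∫ dY [ 2 (|S_Y| / L³) ∫_{S_Y} |Ψ(·,Y)|² + 2 ∫_{Λ_L \ S_Y} |Ψ(·,Y)|² ]`;
  with `|S_Y| ≤ θ L³` and leakage `∫_{Λ \ S_Y} |Ψ(·,Y)|² ≤ ε Q(Y)` this is `N₀ ≤ 2 (θ + ε) N ‖Ψ‖²` —
  the soft-set version, for the flat mode, of the rigidity bound `Theorems/SoloInformedRigidityBound`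
  (which treats exact confinement `Ψ = 0` off `S` and arbitrary modes).

Together with `SoloInformed.flatOccupation_ge_of_nonconfined` (non-confinement `NC(θL³, ε)` on a set
of environments of `μ̂`-mass `c` gives `N₀ ≥ c ε² θ N`) this makes the zero-momentum condensate
fraction of a nonnegative `Ψ` and the non-confinement probability of its conditional one-particle law
EQUIVALENT up to explicit powers: `N₀/N ≥ δ` forces `μ̂[NC(δL³/8, δ/8)] ≥ δ/2` (Markov on
`m(Y) ≤ 1` and the bound above with `θ = ε = δ/8`), and `μ̂[NC(θL³, ε)] ≥ c` forces `N₀/N ≥ c θ ε²`.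
Hence ground-state BEC in the sense of the conjunct (via `SoloInformed.hasGroundStateBEC_of_flatOccupation`)
is exactly a quantitative deletion-tolerance / non-rigidity statement for the ground-state point
process, uniformly in the volume. No energy estimate enters. [folklore]-level measure theory; the
identification is the content claimed. Companion report: the soloist seat's `paper/sharpest.md` §3.
-/

noncomputable section

open MeasureTheory Filter Set
open scoped ENNReal NNReal ComplexConjugate

namespace Summit.AtomisticToContinuum.BoseEinsteinCondensation.Theorems

open Literature.MathematicalPhysics.QuantumManyBody.BoseGas

/-! ### Abstract part: Cauchy–Schwarz split along a confining set -/

section Abstract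

variable {α : Type*} [MeasurableSpace α] {μ : Measure α} {f : α → ℝ≥0∞} {B S : Set α}

/-- Cauchy–Schwarz on a set: `(∫_D f)² ≤ μ(D) ∫_D f²`. [folklore] -/
theorem SoloInformed.sq_setLIntegral_le_measure_mul (hf : Measurable f) (D : Set α) :
    (∫⁻ x in D, f x ∂μ) ^ 2 ≤ μ D * ∫⁻ x in D, f x ^ 2 ∂μ := by
  have h := lintegral_mul_sq_le (μ.restrict D) (f := fun _ => (1 : ℝ≥0∞)) (g := f)
    aemeasurable_const hf.aemeasurable
  simpa using h

/-- **Soft confinement ⇒ small `L¹`-to-`L²` ratio.** For `S ⊆ B`: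
`(∫_B f)² ≤ 2 μ(S) ∫_S f² + 2 μ(B) ∫_{B \ S} f²` (split `∫_B f = ∫_S f + ∫_{B\S} f`, Cauchy–Schwarz
on each piece, `(a+b)² ≤ 2a² + 2b²`). [folklore] -/
theorem SoloInformed.sq_setLIntegral_le_of_softConfined (hf : Measurable f) (hS : MeasurableSet S)
    (hSB : S ⊆ B) :
    (∫⁻ x in B, f x ∂μ) ^ 2 ≤
      2 * (μ S * ∫⁻ x in S, f x ^ 2 ∂μ) + 2 * (μ B * ∫⁻ x in B \ S, f x ^ 2 ∂μ) := by
  have hsplit : ∫⁻ x in B, f x ∂μ = ∫⁻ x in S, f x ∂μ + ∫⁻ x in B \ S, f x ∂μ := by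
    rw [← lintegral_inter_add_sdiff f B hS, Set.inter_eq_right.2 hSB]
  have hab : ∀ a b : ℝ≥0∞, (a + b) ^ 2 ≤ 2 * a ^ 2 + 2 * b ^ 2 := by
    intro a b
    have h := ENNReal.rpow_add_le_mul_rpow_add_rpow a b (p := 2) one_le_two
    norm_num [ENNReal.rpow_two] at h
    simpa [mul_add] using h
  calc (∫⁻ x in B, f x ∂μ) ^ 2 = (∫⁻ x in S, f x ∂μ + ∫⁻ x in B \ S, f x ∂μ) ^ 2 := by rw [hsplit]
    _ ≤ 2 * (∫⁻ x in S, f x ∂μ) ^ 2 + 2 * (∫⁻ x in B \ S, f x ∂μ) ^ 2 := hab _ _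
    _ ≤ 2 * (μ S * ∫⁻ x in S, f x ^ 2 ∂μ) + 2 * (μ (B \ S) * ∫⁻ x in B \ S, f x ^ 2 ∂μ) :=
        add_le_add (mul_le_mul_right (SoloInformed.sq_setLIntegral_le_measure_mul hf S) 2)
          (mul_le_mul_right (SoloInformed.sq_setLIntegral_le_measure_mul hf (B \ S)) 2)
    _ ≤ 2 * (μ S * ∫⁻ x in S, f x ^ 2 ∂μ) + 2 * (μ B * ∫⁻ x in B \ S, f x ^ 2 ∂μ) :=
        add_le_add le_rfl
          (mul_le_mul_right (mul_le_mul_left (measure_mono Set.sdiff_subset) _) 2)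

end Abstract

/-! ### The flat mode -/

variable {n : ℕ}

/-- **Flat-mode overlap of a complex wave function (triangle inequality).**
`|∫ conj(L^{-3/2} 1_{Λ_L}) Ψ(·, Y)| ≤ L^{-3/2} ∫_{Λ_L} |Ψ(x, Y)| dx`. [folklore] -/
theorem SoloInformed.nnnorm_flatOverlap_le {Ψ : Config (n + 1) → ℂ} (hΨ : Measurable Ψ) (L : ℝ)
    (Y : Config n) :
    (‖∫ x, conj ((box L).indicator (fun _ => ((Real.sqrt ((L ^ 3)⁻¹) : ℝ) : ℂ)) x) *
        Ψ (Matrix.vecCons x Y)‖₊ : ℝ≥0∞) ≤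
      ENNReal.ofReal (Real.sqrt ((L ^ 3)⁻¹)) *
        ∫⁻ x in box L, (‖Ψ (Matrix.vecCons x Y)‖₊ : ℝ≥0∞) := by
  set c : ℝ := Real.sqrt ((L ^ 3)⁻¹) with hcdef
  have hc0 : 0 ≤ c := Real.sqrt_nonneg _
  have hmeas : MeasurableSet (box L) := by
    rw [SoloInformed.box_eq_preimage]
    exact (PiLp.continuous_ofLp 2 _).measurable (MeasurableSet.univ_pi fun _ => measurableSet_Ioo)
  have hpt : ∀ x, (‖conj ((box L).indicator (fun _ => ((c : ℝ) : ℂ)) x) *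
      Ψ (Matrix.vecCons x Y)‖₊ : ℝ≥0∞) =
      (box L).indicator (fun x => ENNReal.ofReal c * (‖Ψ (Matrix.vecCons x Y)‖₊ : ℝ≥0∞)) x := by
    intro x
    by_cases hx : x ∈ box L
    · rw [Set.indicator_of_mem hx, Set.indicator_of_mem hx, nnnorm_mul, ENNReal.coe_mul,
        RCLike.nnnorm_conj, SoloInformed.coe_nnnorm_ofReal_of_nonneg hc0]
    · simp [hx]
  calc (‖∫ x, conj ((box L).indicator (fun _ => ((c : ℝ) : ℂ)) x) * Ψ (Matrix.vecCons x Y)‖₊ : ℝ≥0∞)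
      ≤ ∫⁻ x, (‖conj ((box L).indicator (fun _ => ((c : ℝ) : ℂ)) x) *
          Ψ (Matrix.vecCons x Y)‖₊ : ℝ≥0∞) := by
        rw [← enorm_eq_nnnorm]
        simp_rw [← enorm_eq_nnnorm]
        exact enorm_integral_le_lintegral_enorm _
    _ = ∫⁻ x, (box L).indicator
          (fun x => ENNReal.ofReal c * (‖Ψ (Matrix.vecCons x Y)‖₊ : ℝ≥0∞)) x := by
        refine lintegral_congr fun x => hpt x
    _ = ENNReal.ofReal c * ∫⁻ x in box L, (‖Ψ (Matrix.vecCons x Y)‖₊ : ℝ≥0∞) := by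
        rw [lintegral_indicator hmeas,
          lintegral_const_mul _ (measurable_comp_vecCons_left hΨ Y).nnnorm.coe_nnreal_ennreal]

/-- **Soft confinement bounds the zero-momentum occupation (quantitative).** Let `Ψ` be measurable,
`L > 0`, and let `S_Y ⊆ Λ_L` be a measurable confining set for each environment `Y`. Then
`⟨φ₀, γ_Ψ φ₀⟩ ≤ N ∫ dY [ 2 (|S_Y|/L³) ∫_{S_Y} |Ψ(·,Y)|² + 2 ∫_{Λ_L \ S_Y} |Ψ(·,Y)|² ]`,
`φ₀ = L^{-3/2} 1_{Λ_L}`, `N = n + 1`. In particular, if `|S_Y| ≤ θ L³` and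
`∫_{Λ \ S_Y} |Ψ(·,Y)|² ≤ ε Q(Y)` for (`μ̂`-almost) every `Y`, then `N₀ ≤ 2(θ + ε) N ‖Ψ‖²`:
confinement of the conditional law of one particle to a vanishing volume fraction, up to a vanishing
leakage, kills zero-momentum condensation. [folklore] -/
theorem SoloInformed.flatOccupation_le_of_softConfined {Ψ : Config (n + 1) → ℂ} (hΨ : Measurable Ψ)
    {L : ℝ} (hL : 0 < L) (S : Config n → Set Space) (hS : ∀ Y, MeasurableSet (S Y))
    (hSB : ∀ Y, S Y ⊆ box L) :
    occupation (n + 1) ((box L).indicator (fun _ => ((Real.sqrt ((L ^ 3)⁻¹) : ℝ) : ℂ))) Ψ ≤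
      (n + 1 : ℝ≥0∞) * ∫⁻ Y,
        (2 * ((ENNReal.ofReal (L ^ 3))⁻¹ * volume (S Y)) *
            (∫⁻ x in S Y, (‖Ψ (Matrix.vecCons x Y)‖₊ : ℝ≥0∞) ^ 2) +
          2 * ∫⁻ x in box L \ S Y, (‖Ψ (Matrix.vecCons x Y)‖₊ : ℝ≥0∞) ^ 2) := by
  have hκ : 0 ≤ (L ^ 3)⁻¹ := inv_nonneg.2 (pow_nonneg hL.le 3)
  have hc2 : ENNReal.ofReal (Real.sqrt ((L ^ 3)⁻¹)) ^ 2 = (ENNReal.ofReal (L ^ 3))⁻¹ := by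
    rw [← ENNReal.ofReal_pow (Real.sqrt_nonneg _), Real.sq_sqrt hκ,
      ENNReal.ofReal_inv_of_pos (pow_pos hL 3)]
  have hV : (ENNReal.ofReal (L ^ 3))⁻¹ * volume (box L) = 1 := by
    rw [SoloInformed.volume_box hL.le]
    exact ENNReal.inv_mul_cancel (ENNReal.ofReal_pos.2 (pow_pos hL 3)).ne' ENNReal.ofReal_ne_top
  rw [occupation]
  refine mul_le_mul_right (lintegral_mono fun Y => ?_) _
  calc (‖∫ x, conj ((box L).indicator (fun _ => ((Real.sqrt ((L ^ 3)⁻¹) : ℝ) : ℂ)) x) *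
          Ψ (Matrix.vecCons x Y)‖₊ : ℝ≥0∞) ^ 2
      ≤ (ENNReal.ofReal (Real.sqrt ((L ^ 3)⁻¹)) *
          ∫⁻ x in box L, (‖Ψ (Matrix.vecCons x Y)‖₊ : ℝ≥0∞)) ^ 2 :=
        pow_le_pow_left' (SoloInformed.nnnorm_flatOverlap_le hΨ L Y) 2
    _ = (ENNReal.ofReal (L ^ 3))⁻¹ * (∫⁻ x in box L, (‖Ψ (Matrix.vecCons x Y)‖₊ : ℝ≥0∞)) ^ 2 := by
        rw [mul_pow, hc2]
    _ ≤ (ENNReal.ofReal (L ^ 3))⁻¹ *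
          (2 * (volume (S Y) * ∫⁻ x in S Y, (‖Ψ (Matrix.vecCons x Y)‖₊ : ℝ≥0∞) ^ 2) +
            2 * (volume (box L) * ∫⁻ x in box L \ S Y, (‖Ψ (Matrix.vecCons x Y)‖₊ : ℝ≥0∞) ^ 2)) :=
        mul_le_mul_right
          (SoloInformed.sq_setLIntegral_le_of_softConfined
            (measurable_comp_vecCons_left hΨ Y).nnnorm.coe_nnreal_ennreal (hS Y) (hSB Y)) _
    _ = 2 * ((ENNReal.ofReal (L ^ 3))⁻¹ * volume (S Y)) *
            (∫⁻ x in S Y, (‖Ψ (Matrix.vecCons x Y)‖₊ : ℝ≥0∞) ^ 2) +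
          2 * (((ENNReal.ofReal (L ^ 3))⁻¹ * volume (box L)) *
            ∫⁻ x in box L \ S Y, (‖Ψ (Matrix.vecCons x Y)‖₊ : ℝ≥0∞) ^ 2) := by
        ring
    _ = _ := by rw [hV, one_mul]

end Summit.AtomisticToContinuum.BoseEinsteinCondensation.Theorems

end
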